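import Mathlib
import Literature.Combinatorics.Optimization.SheraliAdamsLocalDistributions
import Literature.Combinatorics.Optimization.PathDecomposableMulticuts
import Literature.Combinatorics.Optimization.RandomGapGraphs
import HarnessLib

/-!
# The graph family behind the Charikar–Makarychev–Makarychev MAX-CUT gap (random regular graphs:
# small cuts and locally path-decomposable subgraphs)

[topic Combinatorics/Optimization]

The proof of [CharikarMakarychevMakarychev2009] Theorem 5.3 (the Sherali–Adams gap for MAX-CUT,
the tree's `CharikarMakarychevMakarychev2009_maxCutSA`) starts (p. 11): "Consider a graph
`G = (V, E)` with maximum degree `∆` such that 1. every cut cuts at most `1/2 + ε/6` fraction of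
all edges; 2. every subgraph on `k` vertices is `Ω(log(n/k))`-path decomposable."  The existence of
such graphs for every `ε > 0` (with `∆ = ∆(ε)`) and all large `n` is taken from the literature
(p. 10): "It is known (see [1], [6], [18]) that for every `ε > 0` there exists `∆` such that with
high probability every cut in a random `∆`-regular graph cuts at most `1/2 + ε` fraction of all
edges … Arora, Bollobás, Lovász, and Tourlakis [1] proved that with high probability we can
remove `o(n)` edges from a random `∆`-regular graph so that every subgraph on `k` vertices is
`Ω(log(n/k))`-path decomposable (here, the constant in the `Ω`-notation depends on `∆`)";
[1] = [AroraBollobasLovaszTourlakis2006] (Lemma 2.8: the random graph, after deleting one edge from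
each short cycle, has girth `≥ g` and all its subgraphs on `ℓ ≤ βn` vertices have at most `(1+η)ℓ`
edges; Lemma 2.12: a `2`-connected `(1+η)`-sparse graph which is not a cycle contains a path of
length `≥ ℓ+1` whose internal vertices have degree `2`, `η < 1/(3ℓ−1)`); restated as
[CharikarMakarychevMakarychev2010] Lemma 3.6 ("every subset of `k` points has sparsity
`1 + O(1/log(n/k))`. Therefore, this expander is `Ω(log(n/k))`-path decomposable").

This file records that graph-theoretic input as ONE named fact, in the vocabulary in which the
formalised proof of Theorem 5.3 consumes it: edge sets `E : Finset (Sym2 (Fin n))`, cuts measured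
by `cutFn` (as in `SAAchieves`/`not_SAAchieves_maxCut_of_localCorrelations`), and path
decomposability in the hereditary form `Multicut.PathDecomposable` of
`PathDecomposableMulticuts.lean` (Def. 2.3 of [CMM09] implies it: a non-separable edge set with at
least two edges is `2`-connected).  Only the special case used in the proof is stated: subgraphs on
at most `√n` vertices, path length `c·log n` (for `k ≤ √n`, `log(n/k) ≥ (log n)/2`).
-- TODO(general form): all `k ≤ n` with path length `c·log(n/k)`; the vertex-cover clause of p. 10.

It is PROVED (`CharikarMakarychevMakarychev2009_gapGraphs_holds`, appended) by the first-moment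
computation over the random pair multigraph with alterations of `RandomPairMultigraphCuts.lean`,
`RandomPairMultigraphSparsity.lean`, `RandomPairMultigraphPruned.lean`, `RandomGapGraphs.lean`
([AroraBollobasLovaszTourlakis2006] §2.1 method) and `SparsePathDecomposable.lean`
([AroraBollobasLovaszTourlakis2006] Lemma 2.12); the reduction of
`CharikarMakarychevMakarychev2009_maxCutSA` to it is `MaxCutSheraliAdamsGap.lean`.

## References

* [CharikarMakarychevMakarychev2009] M. Charikar, K. Makarychev, Y. Makarychev, *Integrality gaps for
  Sherali–Adams relaxations*, STOC 2009, §5 (p. 10, last paragraph; p. 11, proof of Thm 5.3, items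
  1–2).  Held text `paper:doi-10-1145-1536414-1536455`.
* [AroraBollobasLovaszTourlakis2006] S. Arora, B. Bollobás, L. Lovász, I. Tourlakis, *Proving
  integrality gaps without knowing the linear program*, Theory of Computing 2 (2006) 19–51,
  Lemma 2.8 (p. 26), Lemma 2.12 (p. 28).  Held text `paper:doi-10-1109-sfcs-2002-1181954`.
* [CharikarMakarychevMakarychev2010] M. Charikar, K. Makarychev, Y. Makarychev, *Local global
  tradeoffs in metric embeddings*, SIAM J. Comput. 39 (2010), Lemma 3.6 (p. 19 of the held text).
-/

noncomputable section

open Finset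

namespace Literature.Combinatorics.Optimization

/-- **The MAX-CUT gap graphs of [CMM09] §5** (random `∆`-regular graphs with `o(n)` edges removed,
[CMM09] p. 10–11 citing [AroraBollobasLovaszTourlakis2006] Lemmas 2.8/2.12): for every `ε > 0`
there are `∆ ∈ ℕ` and `c > 0` such that for all large `n` there is a loopless nonempty edge set `E`
on `n` vertices with

1. maximum degree `≤ ∆`;
2. every cut cuts at most a `1/2 + ε` fraction of the edges: `Σ_{e∈E} cutFn e x ≤ (1/2+ε)|E|` for
   every `x : Fin n → Bool` ("every cut cuts at most `1/2 + ε/6` fraction of all edges");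
3. every sub-edge-set `E' ⊆ E` covering at most `√n` vertices is `⌊c·log n⌋`-path decomposable
   ("every subgraph on `k` vertices is `Ω(log(n/k))`-path decomposable", used for `k ≤ √n`), in
   the hereditary form `Multicut.PathDecomposable`.

[cite: CharikarMakarychevMakarychev2009, §5 p. 10 (last paragraph) and proof of Thm 5.3 items 1–2 (p. 11); AroraBollobasLovaszTourlakis2006, Lemma 2.8 and Lemma 2.12; CharikarMakarychevMakarychev2010, Lemma 3.6] -/
def CharikarMakarychevMakarychev2009_gapGraphs : Prop :=
  ∀ ε : ℝ, 0 < ε → ∃ Δ : ℕ, ∃ c : ℝ, 0 < c ∧ ∃ n₀ : ℕ, ∀ n : ℕ, n₀ ≤ n →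
    ∃ E : Finset (Sym2 (Fin n)), E.Nonempty ∧ (∀ e ∈ E, ¬ e.IsDiag) ∧
      (∀ v : Fin n, (E.filter fun e => v ∈ e).card ≤ Δ) ∧
      (∀ x : Fin n → Bool, ∑ e ∈ E, cutFn e x ≤ (1 / 2 + ε) * E.card) ∧
      (∀ E' ⊆ E, ((Multicut.supp E').card : ℝ) ^ 2 ≤ n →
        Multicut.PathDecomposable ⌊c * Real.log n⌋₊ E')

/-- Unfolding lemma. [cite: CharikarMakarychevMakarychev2009, §5 (p. 10–11)] -/
theorem CharikarMakarychevMakarychev2009_gapGraphs_iff :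
    CharikarMakarychevMakarychev2009_gapGraphs ↔
      ∀ ε : ℝ, 0 < ε → ∃ Δ : ℕ, ∃ c : ℝ, 0 < c ∧ ∃ n₀ : ℕ, ∀ n : ℕ, n₀ ≤ n →
        ∃ E : Finset (Sym2 (Fin n)), E.Nonempty ∧ (∀ e ∈ E, ¬ e.IsDiag) ∧
          (∀ v : Fin n, (E.filter fun e => v ∈ e).card ≤ Δ) ∧
          (∀ x : Fin n → Bool, ∑ e ∈ E, cutFn e x ≤ (1 / 2 + ε) * E.card) ∧
          (∀ E' ⊆ E, ((Multicut.supp E').card : ℝ) ^ 2 ≤ n →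
            Multicut.PathDecomposable ⌊c * Real.log n⌋₊ E') :=
  Iff.rfl

/-- **The gap graphs exist** — discharge of the named fact by the random pair multigraph
construction (`RandomPairs.exists_gapGraphs`).
[cite: CharikarMakarychevMakarychev2009, §5 p. 10–11; AroraBollobasLovaszTourlakis2006, Lemma 2.8 and Lemma 2.12] -/
theorem CharikarMakarychevMakarychev2009_gapGraphs_holds : CharikarMakarychevMakarychev2009_gapGraphs :=
  RandomPairs.exists_gapGraphs

end Literature.Combinatorics.Optimization
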